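import Mathlib
import Summits.Ventures.HodgeRepro.Tier4.Target
import Summits.Ventures.HodgeRepro.Tier4.Common.TargetBall
import Summits.Ventures.HodgeRepro.Tier4.Line3.KMDatum
import Summits.Ventures.HodgeRepro.Tier4.Line3.BallChangeOfVariables

/-!
# Tier4/Line3/MajInvariance — the majorant `(y,y)_z` is `U(2,1)`-invariant

Blind re-derivation cell `pub-hodge-repro`, Tier 4 «PROVE THE STEP» (README §9–§10), LINE L3, seat t4-L2-p3 (gen 2,
on L3.5 `term_dominated`); rung (I1) of the invariant-majorant route to the residual `OffMainMass` (S12951).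

`maj y z = y^* J y + 2 ‖w_z^* J y‖² / (1 − |z|²)` (`w_z = lift3 z`) is the minimal positive-definite majorant of `J`
attached to the negative line of `z ∈ 𝔹` (`KMDatum`, Kudla–Millson shape).  Its docstring records the invariance
`maj (M y) (M z) = maj y z` for `M ∈ U(2,1)`; this module makes it a theorem (`maj_actM`): for `Mᴴ J M = J` and
`z ∈ 𝔹`, `(M y)^* J (M y) = y^* J y` (`J`-unitarity), `w_{Mz} = j⁻¹ · M w_z` with `j = (M w_z)₂ ≠ 0` (`lift3_actM`),
so `w_{Mz}^* J (M y) = conj(j)⁻¹ · w_z^* J y` (sesquilinearity), and `1 − |Mz|² = (1 − |z|²) / |j|²`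
(`one_sub_nsq_actM`); the two factors `|j|²` cancel.  Consequence: the Gaussian `e^{−c · maj (ballCoord x) z}` of
the kernel is a `Γ`-INVARIANT function of `(x, z)` — the ingredient that lets the majorant of L3.5's off-main density
be an invariant density (no good domain, no size of coset representatives).

Mathlib-level; nothing of the line's data enters.  Nothing here asserts anything about the truth of (P); HC_CM is NOT
proved by anyone in this repository.
-/

set_option autoImplicit false

noncomputable section

namespace Summit.Ventures.HodgeRepro.Tier4.Line3

open Summit.Ventures.HodgeRepro.Tier4
open Matrix
open scoped ComplexConjugate

section MajInvariance

variable {M : Matrix (Fin 3) (Fin 3) ℂ}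

/-- A matrix preserving `J` preserves the sesquilinear form `w̄ᵀ J y` (two vectors; `star_dotProduct_J_mulVec_mulVec`
is the case `w = y`). -/
theorem star_dotProduct_J_mulVec_mulVec₂ (hM : Mᴴ * J * M = J) (w y : Fin 3 → ℂ) :
    star (M *ᵥ w) ⬝ᵥ (J *ᵥ (M *ᵥ y)) = star w ⬝ᵥ (J *ᵥ y) := by
  rw [Matrix.star_mulVec, Matrix.mulVec_mulVec, Matrix.dotProduct_mulVec, Matrix.vecMul_vecMul,
    ← Matrix.mul_assoc, hM, ← Matrix.dotProduct_mulVec]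

/-- The pairing of the lifted image point with `M y`: `w_{Mz}^* J (M y) = conj(j)⁻¹ · (w_z^* J y)`,
`j = (M w_z)₂`. -/
theorem star_lift3_actM_dotProduct (hM : Mᴴ * J * M = J) (y : Fin 3 → ℂ) {z : Fin 2 → ℂ} (hz : z ∈ ball) :
    star (lift3 (actM M z)) ⬝ᵥ (J *ᵥ (M *ᵥ y)) =
      (star ((M *ᵥ lift3 z) 2))⁻¹ * (star (lift3 z) ⬝ᵥ (J *ᵥ y)) := by
  have h2 := mulVec_lift3_two_ne_zero hM hz
  rw [lift3_actM h2, star_smul, smul_dotProduct, star_inv₀, smul_eq_mul,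
    star_dotProduct_J_mulVec_mulVec₂ hM (lift3 z) y]

/-- **THE MAJORANT IS `U(2,1)`-INVARIANT**: `maj (M y) (actM M z) = maj y z` for `Mᴴ J M = J` and `z ∈ 𝔹`. -/
theorem maj_actM (hM : Mᴴ * J * M = J) (y : Fin 3 → ℂ) {z : Fin 2 → ℂ} (hz : z ∈ ball) :
    maj (M *ᵥ y) (actM M z) = maj y z := by
  have h2 := mulVec_lift3_two_ne_zero hM hz
  have hn : 0 < ‖(M *ᵥ lift3 z) 2‖ ^ 2 := by positivity
  have hs : 0 < 1 - nsq z := sub_pos.mpr hz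
  unfold maj
  rw [star_dotProduct_J_mulVec_mulVec₂ hM y y, star_lift3_actM_dotProduct hM y hz, norm_mul, norm_inv,
    norm_star, mul_pow, inv_pow, one_sub_nsq_actM hM hz]
  field_simp

/-- The Gaussian of the majorant is invariant: `exp (−c · maj (M y) (actM M z)) = exp (−c · maj y z)`. -/
theorem exp_maj_actM (hM : Mᴴ * J * M = J) (c : ℝ) (y : Fin 3 → ℂ) {z : Fin 2 → ℂ} (hz : z ∈ ball) :
    Real.exp (-(c * maj (M *ᵥ y) (actM M z))) = Real.exp (-(c * maj y z)) := by
  rw [maj_actM hM y hz]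

end MajInvariance

end Summit.Ventures.HodgeRepro.Tier4.Line3

end
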